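import Summits.CriticalPhenomena.PercolationContinuityZ3.Theorems.Transplant.SkelSign2ParamsFaceVal
import HarnessLib

/-!
# D″ L7′ params, part 14b: UNPACKING `signChoice₂` FOR THE FACE RESIDUE (F), continued — the two bands of the (F) schedule (binder group (f):
# `hOK hℓ₁₁ hℓ₁₂`, `hfit`, `hreachL hnmax`) and the inner chain's route rooms and excess radius (group (g)), under `hat : (Sgn₂.choiceAt κ Φ t p hC).AtQ O q`;
# the (F) values and groups (a) (b) (d) (e) and the first hop are in part 14a (`SkelSign2ParamsFaceVal`). hp-8 g30's `faceHoldsRFn_signChoice₂` imports THIS file.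

builds on p205010 (kernel theorem, internal audit signed; external expert review pending) — nothing in this file uses p205010.
Status sentence (coordinator 2026-08-20T04:30Z): "θ(p_c) = 0 on ℤ^d, all d ≥ 2 — kernel-verified (Lean 4/Mathlib, standard axioms); internal adversarial
audit SIGNED 2026-08-20 04:29Z; external expert review pending."
Lane `prim-bschramm-*`, seat `prim-bschramm-stmt` (gen 9); helper file (`--supports stmt-CriticalPhenomena-4575`).
FACTS (this file): `face_twoBand_at` (`hOK hℓ₁₁ hℓ₁₂`, admissible for EVERY `lv`); `face_fit_at` (`hfit`, the eight `FaceRunFit2` inequalities on the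
`Rlev`-enlarged face rows); `face_reach_at` (`hreachL hnmax`); `face_inner_route_at`, `face_inner_excess_at` ((g)); the chain property itself is
`Sgn₂.inner_chain` (AtQ2) at `G' := winGraph G c Lin`.
[cite: KozmaNitzan2024, §4 pp. 26–31 (Step III), Lemma 11 (pp. 22–23), Lemma 12 (pp. 23–25)]
-/

noncomputable section

open MeasureTheory
open scoped Classical

namespace Summit.CriticalPhenomena.PercolationContinuityZ3.Theorems.Transplant

namespace PlanarSkeletonSign

namespace Sgn₂

open Literature.Probability.Percolation Literature.Probability.LatticeModels SimpleGraph
open Literature.Probability.Percolation.KozmaNitzan.Cells (oth oth_oth)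
open Literature.Barriers.CriticalPhenomena (graphBall graphBall_mono)
open SkelConc (Consts)
open Sgn (K a A L twenty_le_K one_le_a hundred_le_A K_le_A five_le_L sixteen_L_le_A δkit δI m₀ Mu ρz M T₀ Kd Rseed rs cU sB B kP NP Lcnt Rlev R' η reachK Sz L_hyps)
open SkelI (tanOff)
open ChainPlanar
open Skel (excess)

section AtQ

variable {κ : Consts} {V : Type} [DecidableEq V] [Countable V] {G : SimpleGraph V} [G.LocallyFinite] {Φ : PlanarSkeletonSign G}
  {t : V} {p : unitInterval} {hC : Φ.CylSubcritical p} {O : Skelφ.StepI.Out V} {q : unitInterval}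
  (hat : (choiceAt κ Φ t p hC).AtQ O q)
include hat

/-! ## §5 (f): the two bands of the (F) schedule — admissibility for EVERY `lv`, the fits on the face rows, the reach, the count ceiling -/

/-- **The (F) schedule is admissible for EVERY level `lv`** (`hOK`): `FaceRun.TwoBandOKR q′₁ e ρ₁N R′ ℓ₀ (L−1) WMR WbR sL ρ₂N ℓ₀ (N₂F lv) WMC WbR`, and the
extent tops `hℓ₁₁ : 2·0 + e + R′ ≤ e + R′`, `hℓ₁₂ : 2·0 + sL + R′ ≤ ℓtop`. [cite: KozmaNitzan2024, §4 Lemma 11 (p. 22)] -/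
theorem face_twoBand_at (i : Fin 2) (lv : ℤ) :
    FaceRun.TwoBandOKR (qR' κ Φ p O i : ℤ) (e κ Φ p O i : ℤ) (ρ₁N κ Φ p O i : ℤ) (R' κ Φ p O) (ℓ₀ κ Φ p O i) (L κ - 1) (WMR κ Φ p O i)
      (WbR κ Φ p O i) (sL κ Φ p O i : ℤ) (ρ₂N κ Φ p O i : ℤ) (ℓ₀ κ Φ p O i) (N₂F κ Φ p O i lv) (WMC κ Φ p O i) (WbR κ Φ p O i) ∧
    2 * (0 : ℤ) + (e κ Φ p O i : ℤ) + R' κ Φ p O ≤ ((e κ Φ p O i + R' κ Φ p O : ℕ) : ℤ) ∧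
    2 * (0 : ℤ) + (sL κ Φ p O i : ℤ) + R' κ Φ p O ≤ (ℓtop κ Φ p O i : ℤ) := by
  obtain ⟨h1, h2, h3, h4, hSL, -, -, -, -, -, hmono, -⟩ := face_units_at hat i
  have hL1 := cast_L_pred (κ := κ)
  have hW := (root_std_at hat i).2.2.2.2.2.2.2
  have hb := extents_le_at hat i
  have hk0 : O.D.k ≤ ℓ₀ κ Φ p O i := (Mu_succ_le_ℓ₀_at hat i).2
  have hR0 : (0 : ℤ) ≤ R' κ Φ p O := Int.natCast_nonneg _
  have hN : ((N₂F κ Φ p O i lv : ℤ) + 1) * R' κ Φ p O ≤ ((NcapF κ Φ p O i : ℤ) + 1) * R' κ Φ p O :=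
    mul_le_mul_of_nonneg_right (by exact_mod_cast Nat.succ_le_succ (hmono lv)) hR0
  refine ⟨⟨⟨le_rfl, Int.natCast_nonneg _, by exact_mod_cast h1, by exact_mod_cast h2, ?_, fun ℓ hℓ => hW ℓ (by omega)⟩,
    ⟨le_rfl, by positivity, by exact_mod_cast h3, by exact_mod_cast h4, ?_, fun ℓ hℓ => ?_⟩, ?_⟩, by push_cast; omega, by push_cast; omega⟩
  · rw [hL1]; unfold ρ₁N; push_cast; exact le_rfl
  · unfold ρ₂N; push_cast; linarith
  · have hℓ' : ℓ ≤ ℓtop κ Φ p O i := by omega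
    unfold WbR WMC
    exact widths_oth_mono hat i (hk0.trans (le_max_right _ _)) (max_le hℓ' (hb.1.trans (hb.2.1.trans hb.2.2.1)))
  · have h : sL κ Φ p O i ≤ (L κ - 1 + 2) * e κ Φ p O i := by
      have e1 : L κ - 1 + 2 = L κ + 1 := by have := five_le_L κ; omega
      have ht : ℓtop κ Φ p O i = L κ * e κ Φ p O i := rfl
      rw [e1, Nat.add_mul, one_mul]; omega
    exact_mod_cast h

/-- **The fits on the `Rlev`-enlarged face rows** (`hfit`): for `j + 1 ≤ K`, `faceL j − Rlev ≤ lv ≤ faceL j + Rlev`, `|cbo| ≤ 2 r⊥ + Rlev`, the eight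
`FaceRunFit2` inequalities hold for the (F) schedule of record. [cite: KozmaNitzan2024, §4 p. 30 (F^{j+1}), Lemma 11 (p. 22)] -/
theorem face_fit_at (du : MDir) (j : ℕ) (hj : j + 1 ≤ (cells κ Φ p O).K) (lv cbo : ℤ)
    (h₁ : (cells κ Φ p O).faceL du.1 j - Rlev κ Φ p O ≤ lv) (h₂ : lv ≤ (cells κ Φ p O).faceL du.1 j + Rlev κ Φ p O)
    (h₃ : |cbo| ≤ 2 * ((cells κ Φ p O).r (oth du.1) : ℤ) + Rlev κ Φ p O) :
    PCells2.FaceRunFit2 (cells κ Φ p O) du j lv cbo (ℓ1 κ Φ p O du.1) (qR' κ Φ p O du.1) (e κ Φ p O du.1) (ρ₁N κ Φ p O du.1) (R' κ Φ p O)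
      (L κ - 1) (WMR κ Φ p O du.1) (sL κ Φ p O du.1) (ρ₂N κ Φ p O du.1) (N₂F κ Φ p O du.1 lv) (WMC κ Φ p O du.1)
      (Skelφ.StepI.widths O.D.Gb O.D.Fb du.1 (ℓ1 κ Φ p O du.1)) := by
  obtain ⟨-, -, -, -, hSL, -, hsLr, hte, -, hcapA, hmono, hu, huo, hLR, hpos⟩ := face_units_at hat du.1
  have hL1 := cast_L_pred (κ := κ)
  have hA := hundred_le_A κ
  have hL5 := five_le_L κ
  have hLA : L κ ≤ A κ := by have := (sixteen_L_le_A κ).2; omega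
  have hrw := face_rows_at hat du.1
  have hrwo := face_rows_at hat (oth du.1)
  have hR : R' κ Φ p O = Rlev κ Φ p O + 1 := rfl
  have hℓ1 : ℓ1 κ Φ p O du.1 = Mu O + e κ Φ p O du.1 + 2 * R' κ Φ p O + 1 := rfl
  have ht : ℓtop κ Φ p O du.1 = L κ * e κ Φ p O du.1 := rfl
  have hfl := floor_le_e_at hat du.1
  have hs := cells_s_at hat du.1
  have hr := cells_r_at hat du.1
  have hro := cells_r_at hat (oth du.1)
  have hK : (cells κ Φ p O).K = K κ := (cells_K_at (κ := κ) (Φ := Φ) (p := p) (O := O)).1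
  have hR'e : R' κ Φ p O ≤ e κ Φ p O (oth du.1) := (units_large_at hat (oth du.1)).2.1
  have ha := one_le_a κ
  obtain ⟨-, -, -, -, -, hq8, hW8, -⟩ := root_std_at hat du.1
  have hC8 := (widths_at hat du.1).2.2
  -- ℕ facts: `s (j+1) ≤ r`, `e ≤ s`, `100 e ≤ r` (both axes), the `R′`-multiples, the two transverse rooms, the along-reach
  have hsj : (cells κ Φ p O).s du.1 * (j + 1) ≤ (cells κ Φ p O).r du.1 := by
    rw [hs, hr]
    calc a κ * e κ Φ p O du.1 * (j + 1) ≤ a κ * e κ Φ p O du.1 * K κ := Nat.mul_le_mul_left _ (hK ▸ hj)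
      _ = K κ * a κ * e κ Φ p O du.1 := by ring
  have hes : e κ Φ p O du.1 ≤ (cells κ Φ p O).s du.1 := by rw [hs]; exact Nat.le_mul_of_pos_left _ ha
  have her : 100 * e κ Φ p O du.1 ≤ (cells κ Φ p O).r du.1 := by rw [hr]; exact Nat.mul_le_mul_right _ hA
  have hero : 100 * e κ Φ p O (oth du.1) ≤ (cells κ Φ p O).r (oth du.1) := by rw [hro]; exact Nat.mul_le_mul_right _ hA
  have hRt1 : (L κ - 1 + N₂F κ Φ p O du.1 lv + 2) * R' κ Φ p O ≤ 6 * (A κ * R' κ Φ p O) := by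
    have := Nat.mul_le_mul_right (R' κ Φ p O) (show L κ - 1 + N₂F κ Φ p O du.1 lv + 2 ≤ 6 * A κ by have := hmono lv; omega)
    simpa [Nat.mul_assoc] using this
  have hRt2 : (NcapF κ Φ p O du.1 + 1) * R' κ Φ p O ≤ 5 * (A κ * R' κ Φ p O) := by
    have := Nat.mul_le_mul_right (R' κ Φ p O) hcapA; simpa [Nat.mul_assoc] using this
  have hRt3 : (L κ - 1) * R' κ Φ p O ≤ A κ * R' κ Φ p O := le_trans (Nat.mul_le_mul_right _ (Nat.sub_le _ _)) hLR
  have hρ1 : ρ₁N κ Φ p O du.1 + Rlev κ Φ p O + 2 ≤ 3 * (cells κ Φ p O).r (oth du.1) := by unfold ρ₁N; omega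
  have hρ2 : ρ₂N κ Φ p O du.1 + Rlev κ Φ p O + 2 ≤ 3 * (cells κ Φ p O).r (oth du.1) := by unfold ρ₂N; omega
  have htrM : qR' κ Φ p O du.1 + WMR κ Φ p O du.1 + WMC κ Φ p O du.1 + (L κ - 1 + N₂F κ Φ p O du.1 lv + 2) * R' κ Φ p O + Rlev κ Φ p O ≤
      (cells κ Φ p O).r (oth du.1) := by omega
  have hbig : Rlev κ Φ p O + ℓ1 κ Φ p O du.1 + L κ * e κ Φ p O du.1 + 1 ≤ 2 * (cells κ Φ p O).r du.1 := by omega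
  have hF1n : Rlev κ Φ p O + ℓ1 κ Φ p O du.1 + 3 ≤ 10 * (cells κ Φ p O).s du.1 := by omega
  -- ℤ forms
  have hfL : (cells κ Φ p O).faceL du.1 j = 5 * ((cells κ Φ p O).r du.1 : ℤ) + 10 * ((cells κ Φ p O).s du.1 : ℤ) * ((j + 1 : ℕ) : ℤ) - 1 := rfl
  have zsj : ((cells κ Φ p O).s du.1 : ℤ) * ((j : ℤ) + 1) ≤ (cells κ Φ p O).r du.1 := by exact_mod_cast hsj
  have zs0 : (0 : ℤ) ≤ ((cells κ Φ p O).s du.1 : ℤ) * (j : ℤ) := by positivity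
  have zlv₁ : 5 * ((cells κ Φ p O).r du.1 : ℤ) + 10 * ((cells κ Φ p O).s du.1 : ℤ) * (j : ℤ) + 10 * (cells κ Φ p O).s du.1 - 1 - Rlev κ Φ p O ≤ lv := by
    rw [hfL] at h₁; push_cast at h₁; linarith
  have zlv₂ : lv ≤ 15 * ((cells κ Φ p O).r du.1 : ℤ) - 1 + Rlev κ Φ p O := by
    rw [hfL] at h₂; push_cast at h₂; linarith
  have zrw : (Rlev κ Φ p O : ℤ) + 4 ≤ 10 * (cells κ Φ p O).s du.1 := by exact_mod_cast hrw.1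
  have zℓ1 : (ℓ1 κ Φ p O du.1 : ℤ) = Mu O + e κ Φ p O du.1 + 2 * R' κ Φ p O + 1 := by exact_mod_cast hℓ1
  have zR : (R' κ Φ p O : ℤ) = Rlev κ Φ p O + 1 := by exact_mod_cast hR
  have zρ1 : (ρ₁N κ Φ p O du.1 : ℤ) + Rlev κ Φ p O + 2 ≤ 3 * (cells κ Φ p O).r (oth du.1) := by exact_mod_cast hρ1
  have zρ2 : (ρ₂N κ Φ p O du.1 : ℤ) + Rlev κ Φ p O + 2 ≤ 3 * (cells κ Φ p O).r (oth du.1) := by exact_mod_cast hρ2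
  have ztrM : ((qR' κ Φ p O du.1 + WMR κ Φ p O du.1 + WMC κ Φ p O du.1 + (L κ - 1 + N₂F κ Φ p O du.1 lv + 2) * R' κ Φ p O + Rlev κ Φ p O : ℕ) : ℤ) ≤
      (cells κ Φ p O).r (oth du.1) := by exact_mod_cast htrM
  push_cast at ztrM
  have zbig : (Rlev κ Φ p O : ℤ) + ℓ1 κ Φ p O du.1 + L κ * e κ Φ p O du.1 + 1 ≤ 2 * (cells κ Φ p O).r du.1 := by exact_mod_cast hbig
  have zF1 : (Rlev κ Φ p O : ℤ) + ℓ1 κ Φ p O du.1 + 3 ≤ 10 * (cells κ Φ p O).s du.1 := by exact_mod_cast hF1n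
  have zq8 : 8 * (qR' κ Φ p O du.1 : ℤ) ≤ (cells κ Φ p O).r (oth du.1) := by exact_mod_cast hq8
  have zsLr : (sL κ Φ p O du.1 : ℤ) ≤ (cells κ Φ p O).r du.1 := by exact_mod_cast hsLr
  have zrwo : (Rlev κ Φ p O : ℤ) + 3 ≤ 3 * (cells κ Φ p O).r (oth du.1) := by exact_mod_cast hrwo.2
  have zR'e : (R' κ Φ p O : ℤ) ≤ e κ Φ p O (oth du.1) := by exact_mod_cast hR'e
  have zero' : 100 * (e κ Φ p O (oth du.1) : ℤ) ≤ (cells κ Φ p O).r (oth du.1) := by exact_mod_cast hero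
  -- the clamp is inactive on the face rows: `0 ≤ XF lv ≤ 17 r`
  have hXe : XF κ Φ p O du.1 lv = 17 * ((cells κ Φ p O).r du.1 : ℤ) - lv - ℓ1 κ Φ p O du.1 - L κ * e κ Φ p O du.1 := rfl
  have hX0 : 0 ≤ XF κ Φ p O du.1 lv := by rw [hXe]; linarith
  have hX17 : XF κ Φ p O du.1 lv ≤ 17 * ((cells κ Φ p O).r du.1 : ℤ) := by rw [hXe]; linarith
  have hN2 : N₂F κ Φ p O du.1 lv = FaceRun.N₂of (sL κ Φ p O du.1 : ℤ) (XF κ Φ p O du.1 lv) := by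
    unfold N₂F; rw [min_eq_left hX17, max_eq_right hX0]
  have hsp := FaceRun.N₂of_spec (s₂ := (sL κ Φ p O du.1 : ℤ)) (X := XF κ Φ p O du.1 lv) (by exact_mod_cast hpos) hX0
  rw [← hN2, hXe] at hsp
  refine ⟨?_, ?_, ?_, ?_, ?_, ?_, ?_, ?_⟩
  · -- hbot
    linarith
  · -- htr
    refine le_trans (add_le_add h₃ (max_le (le_max_left _ _) (le_max_right _ _))) ?_
    rcases le_total (ρ₁N κ Φ p O du.1 : ℤ) (ρ₂N κ Φ p O du.1) with h | h
    · rw [max_eq_right h]; linarith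
    · rw [max_eq_left h]; linarith
  · -- hM1
    rw [hL1]; linarith [hsp.1]
  · -- hM2
    rw [hL1]; linarith [hsp.2]
  · -- htrM
    linarith
  · -- hF1
    rw [Skelφ.StepI.widths_self]; linarith
  · -- hF2
    rw [Skelφ.StepI.widths_self]; linarith
  · -- hF3
    unfold qR' at zq8; linarith only [h₃, zq8, zR'e, zero', zR]

/-- **The `ℓ¹`-reach of the (F) schedule fits in the inner window** (`hreachL`, with `L := Lin`) and **its length is below the chain ceiling**
(`hnmax`, with `nmax := Prm.nmax A`), for every `lv`. [folklore] -/
theorem face_reach_at (i : Fin 2) (lv : ℤ) :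
    |(ℓ1 κ Φ p O i : ℤ)| + (((L κ - 1 : ℕ) : ℤ) + 1) * (e κ Φ p O i : ℤ) + ((N₂F κ Φ p O i lv : ℤ) + 1) * (sL κ Φ p O i : ℤ) +
      ((qR' κ Φ p O i : ℤ) + WMR κ Φ p O i + WMC κ Φ p O i + (((L κ - 1 : ℕ) : ℤ) + N₂F κ Φ p O i lv + 2) * R' κ Φ p O) ≤ Lin κ Φ p O q ∧
    L κ - 1 + 1 + N₂F κ Φ p O i lv ≤ Skelφ.Prm.nmax (A κ) := by
  obtain ⟨-, -, -, -, hSL, h4e, hsLr, hte, hcap, hcapA, hmono, hu, huo, hLR, hpos⟩ := face_units_at hat i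
  have hL1 := cast_L_pred (κ := κ)
  have hA := hundred_le_A κ
  have hL5 := five_le_L κ
  have hLA : L κ ≤ A κ := by have := (sixteen_L_le_A κ).2; omega
  have hN := hmono lv
  obtain ⟨-, -, -, -, -, hq8, hW8, -⟩ := root_std_at hat i
  have hC8 := (widths_at hat i).2.2
  have hrim := (face_rim_at hat i).2.2.2.1
  have hrm := (r_le_rmax_at hat i).1
  have hrmo := (r_le_rmax_at hat (oth i)).1
  have hℓ1 : ℓ1 κ Φ p O i = Mu O + e κ Φ p O i + 2 * R' κ Φ p O + 1 := rfl
  have hMu : Mu O < e κ Φ p O i := (units_large_at hat i).2.2.2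
  have her : 100 * e κ Φ p O i ≤ (cells κ Φ p O).r i := by rw [cells_r_at hat i]; exact Nat.mul_le_mul_right _ hA
  -- `(N₂F+1)·sL ≤ NcapF·sL + sL ≤ 17 r + sL`, `(L−1+N₂F+2)·R′ ≤ 6·(A·R′)`
  have hNs : (N₂F κ Φ p O i lv + 1) * sL κ Φ p O i ≤ 17 * (cells κ Φ p O).r i + sL κ Φ p O i := by
    calc (N₂F κ Φ p O i lv + 1) * sL κ Φ p O i ≤ (NcapF κ Φ p O i + 1) * sL κ Φ p O i := Nat.mul_le_mul_right _ (by omega)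
      _ = NcapF κ Φ p O i * sL κ Φ p O i + sL κ Φ p O i := by ring
      _ ≤ _ := by omega
  have hRt1 : (L κ - 1 + N₂F κ Φ p O i lv + 2) * R' κ Φ p O ≤ 6 * (A κ * R' κ Φ p O) := by
    have := Nat.mul_le_mul_right (R' κ Φ p O) (show L κ - 1 + N₂F κ Φ p O i lv + 2 ≤ 6 * A κ by omega)
    simpa [Nat.mul_assoc] using this
  have hnat : ℓ1 κ Φ p O i + L κ * e κ Φ p O i + (N₂F κ Φ p O i lv + 1) * sL κ Φ p O i +
      (qR' κ Φ p O i + WMR κ Φ p O i + WMC κ Φ p O i + (L κ - 1 + N₂F κ Φ p O i lv + 2) * R' κ Φ p O) ≤ Lin κ Φ p O q := by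
    have ht : ℓtop κ Φ p O i = L κ * e κ Φ p O i := rfl
    omega
  refine ⟨?_, by unfold Skelφ.Prm.nmax; omega⟩
  rw [Nat.abs_cast, hL1]
  have hz : (((ℓ1 κ Φ p O i + L κ * e κ Φ p O i + (N₂F κ Φ p O i lv + 1) * sL κ Φ p O i +
      (qR' κ Φ p O i + WMR κ Φ p O i + WMC κ Φ p O i + (L κ - 1 + N₂F κ Φ p O i lv + 2) * R' κ Φ p O) : ℕ) : ℤ)) ≤ Lin κ Φ p O q := by
    exact_mod_cast hnat
  push_cast at hz
  linarith

/-! ## §6 (g): the inner chain's route rooms and excess radius -/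

/-- **Inner route rooms** over the per-axis range `[ℓ₀ᵢ, max (eᵢ + R′) ℓtopᵢ] = [ℓ₀ᵢ, ℓtopᵢ]`: `hMℓ : Mu + 1 ≤ min ℓ₀ ℓ₀`, `hScert` (the range lies in `Sx`
for `i = 0`, in `Sy` for `i = 1`), `hdepthA`, `hWr` (both spreads are `WbR`). [folklore] -/
theorem face_inner_route_at (i : Fin 2) : Mu O + 1 ≤ min (ℓ₀ κ Φ p O i) (ℓ₀ κ Φ p O i) ∧
    (∀ ℓ, min (ℓ₀ κ Φ p O i) (ℓ₀ κ Φ p O i) ≤ ℓ → ℓ ≤ max (e κ Φ p O i + R' κ Φ p O) (ℓtop κ Φ p O i) →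
      (i = 0 → ℓ ∈ Sx κ Φ p O) ∧ (i = 1 → ℓ ∈ Sy κ Φ p O)) ∧
    (∀ I ℓ, min (ℓ₀ κ Φ p O i) (ℓ₀ κ Φ p O i) ≤ ℓ → ℓ ≤ max (e κ Φ p O i + R' κ Φ p O) (ℓtop κ Φ p O i) →
      2 * M O + 2 + tanOff (M O) (M O) + Skelφ.Prm.A O.D (Mu O) I I + O.D.R (Skelφ.amax (Skelφ.StepI.widths O.D.Gb O.D.Fb i ℓ)) ≤ r₀ κ Φ p O) ∧
    (∀ ℓ, min (ℓ₀ κ Φ p O i) (ℓ₀ κ Φ p O i) ≤ ℓ → ℓ ≤ max (e κ Φ p O i + R' κ Φ p O) (ℓtop κ Φ p O i) →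
      Skelφ.StepI.widths O.D.Gb O.D.Fb i ℓ (oth i) ≤ WbR κ Φ p O i ℓ ∧ Skelφ.StepI.widths O.D.Gb O.D.Fb i ℓ (oth i) ≤ WbR κ Φ p O i ℓ) := by
  have hrr := root_route_at hat i
  have h0 := Mu_succ_le_ℓ₀_at hat i
  have hS := Smin_Smax_at hat i
  have hmax : max (e κ Φ p O i + R' κ Φ p O) (ℓtop κ Φ p O i) = ℓtop κ Φ p O i := max_eq_right hrr.2.1
  have hmin : min (ℓ₀ κ Φ p O i) (ℓ₀ κ Φ p O i) = ℓ₀ κ Φ p O i := min_self _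
  rw [hmax, hmin]
  refine ⟨h0.1, fun ℓ ha hb => ⟨fun hi => ?_, fun hi => ?_⟩, fun I ℓ ha hb => hdepth_at hat i I (h0.2.trans ha) (hb.trans hS.2.1),
    fun ℓ ha _ => ⟨?_, ?_⟩⟩
  · subst hi; exact mem_Sx_of_Icc hat ha hb
  · subst hi; exact mem_Sy_of_Icc hat ha hb
  all_goals unfold WbR; exact widths_oth_mono hat i (h0.2.trans ha) (le_max_left _ _)

/-- **The inner excess radius `R₁A = Rex q (2ψMz)` serves EVERY centre with entrances as deep as the wired seed** (`hR₁A`, planar diameter `50 rmax`,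
tolerance `η`), and `R₁A ≤ Lin − r₀` (`hRA` with `Lr := r₀`). [cite: KozmaNitzan2024, §4 Lemma 12 (p. 24)] -/
theorem face_inner_excess_at :
    (∀ (c' : V) (R'' : ℕ), R₁A κ Φ p O q ≤ R'' → ∀ (Rw : ℕ) (D' A' : Finset V), (∀ d ∈ D', d ∈ graphBall G c' Rw) →
      (∀ d ∈ D', ∀ d' ∈ D', Φ.φ d - Φ.φ d' ∈ box 2 (50 * (cells κ Φ p O).rmax)) → A' ⊆ D' →
      (∀ a ∈ A', a ∈ graphBall G c' (Skelφ.fatRadius Φ.frame hC O.D.k + O.off)) →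
        (bondPercolation G q).real (excess G c' R'' D' A') ≤ η κ Φ) ∧
    R₁A κ Φ p O q ≤ Lin κ Φ p O q - r₀ κ Φ p O := by
  have hψ : O.D.R = Skelφ.fatRadius Φ.frame hC := (R_Λ_eq hat).1
  have hdeep : Skelφ.fatRadius Φ.frame hC O.D.k + O.off ≤ 2 * ψMz O := by
    have hmono : Monotone O.D.R := by rw [hψ]; exact Skelφ.fatRadius_mono Φ.frame hC
    have h1 : O.D.R O.D.k ≤ O.D.R (Mu O) := hmono (Mu_facts hat).2.2.2
    have h2 : ρz O ≤ ψMz O := le_max_right _ _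
    have h3 : ρz O = O.D.R (Mu O) + O.off := rfl
    rw [← hψ]; omega
  refine ⟨fun c' R'' hR Rw D' A' hD hbox hAD hA => hRex_at_le hat (2 * ψMz O) (by omega) le_rfl c' R'' hR Rw D' A' hD hbox hAD
    (fun a ha => graphBall_mono G c' hdeep (hA a ha)), ?_⟩
  have h := (face_rim_at hat 0).2.2.2.2.2.2.2
  omega

end AtQ

end Sgn₂

end PlanarSkeletonSign

end Summit.CriticalPhenomena.PercolationContinuityZ3.Theorems.Transplant

end
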